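import Summits.QuantumFields.YangMills.Theorems.BalabanLadderNTReflectionCauchySchwarzPos
import Literature.MathematicalPhysics.QuantumLattice.TwistedBoundaryConditions
import HarnessLib

/-!
# Sketch (g14, lens «dual», seat ym-idea-8) — T-g14-1: the 't Hooft-twist WITNESS floor

Banked TOOL for crux `NT` (stmt-QuantumFields-19353), not a line: a second reflection-positivity
dual witness (after the Wilson loop of route `StaticSourceWitness`), namely the exponential of MINUS
`β` times the action difference of a movable centre-twisted stack `Σ(t₀,s₀)` of `(0,3)`-plaquettes.
Three exact identities (Haar changes of variables by central cochains + torus translations) and the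
tree's positive-half RPCS `Cruxes.NT.Reflection.sq_cov_negReflect_le_odd_pos` give, on every odd torus,

  `(∫W)² · (Σ_y c_y)² · δ² ≤ (1 − (∫W)²) · (∫ F∘ϑ·F − (∫F)²)`,  `∫W = Z_twisted/Z_periodic`,
  `δ = ⟨site action⟩_twisted − ⟨site action⟩_periodic` (position-independent off the stack),

i.e. a FLOOR on the reflection two-point form of any positive-time smearing `F = Σ c_y A_y` of the
site action density by the β-RESPONSE of the twisted free energy (`δ = −N⁻⁴ ∂_β log(Z_tw/Z_per)`).
Statements only (sorried); they elaborate over tree declarations.  Why it is NOT a line on L1–L5: the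
response `(∫W)·δ` dies when the torus outgrows the confinement scale / the support of the test function
(`NT` quantifies `∀ L` at fixed `β`), see the census `Cruxes/NT/Lines/dual_subline_census.md` §T-g14-1.
-/

set_option autoImplicit false

noncomputable section

open MeasureTheory Finset
open Literature.MathematicalPhysics.QuantumFieldTheory
open Literature.MathematicalPhysics.QuantumLattice

namespace Summit.QuantumFields.YangMills.Cruxes.NT.TwistWitness

variable {L N : ℕ} [NeZero L]
variable {G : Type*} [Group G] [TopologicalSpace G] [IsTopologicalGroup G] [CompactSpace G]
  [MeasurableSpace G] [BorelSpace G] (ρ : G →* Matrix (Fin N) (Fin N) ℂ)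

/-- Site action density `A_y(U) = Σ_{μ<ν} (N − Re tr ρ(U_{(y;μ,ν)}))` (all six planes at the site). -/
def siteAction (U : GaugeConfig 4 L G) (y : Site 4 L) : ℝ :=
  ∑ p : Plane 4, ((N : ℝ) - (ρ (plaquetteHolonomy U y p.1.1 p.1.2)).trace.re)

/-- The movable stack `Σ(t₀,s₀)`: base sites of the `(0,3)`-plaquettes with `x 0 = t₀`, `x 3 = s₀`. -/
def stack (t₀ s₀ : ZMod L) : Finset (Site 4 L) :=
  Finset.univ.filter fun x => x 0 = t₀ ∧ x 3 = s₀

/-- The FLIP OBSERVABLE (the dual witness) `W = exp(−β (S_{ζ,Σ} − S))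
= exp(β Σ_{x∈Σ} [Re tr ρ(ζ⁻¹ U_{(x;0,3)}) − Re tr ρ(U_{(x;0,3)})])`: bounded, positive, a function of the
links of the two time layers `t₀, t₀+1` only. -/
def flipObs (ζ : Subgroup.center G) (β : ℝ) (t₀ s₀ : ZMod L) (U : GaugeConfig 4 L G) : ℝ :=
  Real.exp (β * ∑ x ∈ stack t₀ s₀,
    ((ρ ((ζ : G)⁻¹ * plaquetteHolonomy U x 0 3)).trace.re - (ρ (plaquetteHolonomy U x 0 3)).trace.re))

/-- The single-plane twist `z_{(0,3)} = ζ`, all other planes untwisted (tree `Twist 4 G`). -/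
def planeTwist (ζ : Subgroup.center G) : Twist 4 G :=
  fun p => if p.1 = ((0 : Fin 4), (3 : Fin 4)) then ζ else 1

/-- **Identity 1 (flip = twist, moved).** `∫ W dμ_β = Z_{z}(β)/Z(β)` with `z` the `(0,3)`-twist `ζ`
(tree corner convention; the stack is moved from the corner to `(t₀,s₀)` by a central-cochain change of
variables `U(x,3) ↦ ζ U(x,3)` on time layers and a torus translation, both Haar-preserving). -/
theorem integral_flipObs_eq_twistRatio (hρ : Continuous ρ) (β : ℝ) (ζ : Subgroup.center G)
    (t₀ s₀ : ZMod L) :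
    ∫ U, flipObs ρ ζ β t₀ s₀ U ∂(wilsonMeasure ρ β) =
      (twistedPartitionFunction (d := 4) (L := L) ρ (planeTwist ζ) β).toReal /
        (partitionFunction (d := 4) (L := L) ρ β).toReal := by
  sorry

/-- **Identity 2 (position-independence of the response).** Off the stack, the flipped (= twisted)
expectation of the site action density does not depend on the site (`L ≥ 2`): moving the stack past a
site not on it is a Haar change of variables that fixes `A_y`. -/
theorem flip_siteAction_const (hρ : Continuous ρ) (β : ℝ) (ζ : Subgroup.center G) (t₀ s₀ : ZMod L)
    (hL : 2 ≤ L) (y y' : Site 4 L) (hy : ¬ (y 0 = t₀ ∧ y 3 = s₀)) (hy' : ¬ (y' 0 = t₀ ∧ y' 3 = s₀)) :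
    ∫ U, siteAction ρ U y * flipObs ρ ζ β t₀ s₀ U ∂(wilsonMeasure ρ β) =
      ∫ U, siteAction ρ U y' * flipObs ρ ζ β t₀ s₀ U ∂(wilsonMeasure ρ β) := by
  sorry

/-- **Identity 3 (the reflected double stack is pure gauge).** `∫ (W∘ϑ)·W dμ_β = 1` on the odd torus
`L = 2S+1` whenever `2 t₀ + 1 ≢ 0`: `(W∘ϑ)·W · e^{−βS} = e^{−β S''}` with `S''` twisted by `ζ` at `Σ(t₀,s₀)`
and by `ζ⁻¹` at `Σ(−t₀−1,s₀)`, and `U(x,3) ↦ ζ⁻¹U(x,3)` on the slab `−t₀ ≤ x 0 ≤ t₀`, `x 3 = s₀` removes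
both (discrete Stokes for a central 1-cochain). -/
theorem integral_flipObs_negReflect_mul (hρ : Continuous ρ) (β : ℝ) (ζ : Subgroup.center G)
    {S : ℕ} (hLS : L = 2 * S + 1) (t₀ s₀ : ZMod L) (ht₀ : t₀.val + 1 ≤ S) :
    ∫ U, flipObs ρ ζ β t₀ s₀ U.negReflect * flipObs ρ ζ β t₀ s₀ U ∂(wilsonMeasure ρ β) = 1 := by
  sorry

/-- **T-g14-1 — the twist-witness floor.** On the odd torus `L = 2S+1` (`S ≥ 2`, `β ≥ 0`), for a centre
element `ζ`, a stack position `1 ≤ t₀ ≤ S−1`, and real coefficients `c` supported on sites of times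
`1 ≤ y 0 ≤ S − 1` off the stack: with `W` the flip observable, `ϱ := ∫W = Z_tw/Z_per ∈ (0,1]`, the response
`δ := ∫ A_{y₀} W /ϱ − ∫ A_{y₀}` at any reference site `y₀` off the stack, and `F := Σ_y c_y A_y`,
`ϱ² (Σ_y c_y)² δ² ≤ (1 − ϱ²) · (∫ F∘ϑ · F − (∫F)²)`.
Proof: RPCS `sq_cov_negReflect_le_odd_pos` for the pair `(F, W)` (both positive-half observables), Identity 3
for the `W`-diagonal, Identities 1–2 (+ reflection invariance) for the cross term `= ϱ (Σ c) δ`. -/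
theorem twistWitness_floor (hρ : Continuous ρ) {β : ℝ} (hβ : 0 ≤ β) (ζ : Subgroup.center G) {S : ℕ}
    (hLS : L = 2 * S + 1) (hS : 2 ≤ S) (t₀ s₀ : ZMod L) (ht₀ : 1 ≤ t₀.val ∧ t₀.val + 1 ≤ S)
    (c : Site 4 L → ℝ) (hc : ∀ y, c y ≠ 0 → 1 ≤ (y 0).val ∧ (y 0).val + 1 ≤ S ∧ ¬ (y 0 = t₀ ∧ y 3 = s₀))
    (y₀ : Site 4 L) (hy₀ : ¬ (y₀ 0 = t₀ ∧ y₀ 3 = s₀)) :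
    let μ := wilsonMeasure (d := 4) (L := L) ρ β
    let W : GaugeConfig 4 L G → ℝ := flipObs ρ ζ β t₀ s₀
    let F : GaugeConfig 4 L G → ℝ := fun U => ∑ y, c y * siteAction ρ U y
    let ϱ : ℝ := ∫ U, W U ∂μ
    let δ : ℝ := (∫ U, siteAction ρ U y₀ * W U ∂μ) / ϱ - ∫ U, siteAction ρ U y₀ ∂μ
    ϱ ^ 2 * (∑ y, c y) ^ 2 * δ ^ 2 ≤
      (1 - ϱ ^ 2) * (∫ U, F U.negReflect * F U ∂μ - (∫ U, F U ∂μ) ^ 2) := by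
  sorry

/-- Corollaries recorded for the census (informal): `Z_tw ≤ Z_per` (`ϱ ≤ 1`, from Identity 3 and
Cauchy–Schwarz), and `δ = −(L:ℝ)⁻⁴ · d/dβ log (Z_tw/Z_per)` (differentiate Identity 1), so the floor reads
`Cov(F∘ϑ,F) ≥ (Σ c)² (∂_β log ϱ)² ϱ² / (L⁸ (1 − ϱ²))`. -/
theorem twistRatio_le_one (hρ : Continuous ρ) {β : ℝ} (hβ : 0 ≤ β) (ζ : Subgroup.center G) {S : ℕ}
    (hLS : L = 2 * S + 1) (hS : 1 ≤ S) :
    (twistedPartitionFunction (d := 4) (L := L) ρ (planeTwist ζ) β).toReal ≤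
      (partitionFunction (d := 4) (L := L) ρ β).toReal := by
  sorry

end Summit.QuantumFields.YangMills.Cruxes.NT.TwistWitness

end
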